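import Literature.AnabelianGeometry.EtaleTheta.Discharge.Sec4Remark411OfConnectedTemperoid
import Literature.AnabelianGeometry.EtaleTheta.Discharge.Sec3TemperedFrobenioidConnectedPartNonVacuity
import HarnessLib

/-!
# [EtTh] Remark 4.1.1 HOLDS, unconditionally, at the §4 setting over the GENUINE base `B^temp(Π^tp_X)⁰` with toy divisor data

Mochizuki, *The étale theta function …*, Publ. RIMS **45** (2009), §4, Remark 4.1.1, PDF p.88 (printed p.314)
[cite: MochizukiEtTh2009, Rmk 4.1.1 p.88]; Def. 4.1 pp.312–313 (PDF pp.86–87).  Mochizuki, *Semi-graphs of anabelioids*,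
Publ. RIMS **42** (2006) [MochizukiSemiAnbd2006], Rmk. 3.1.3 p.34.

PROOF-ONLY companion (no definition) of `Discharge/Sec4Remark411OfConnectedTemperoid.lean` (abc-iut-f-108 gen 2: the named
fact `BiKummerSetting.Remark411` over `D = ConnectedPart (BTemp X.Pi)` modulo the Galois descent of `Φ` and `B`) and of
abc-iut-w4-d099's `Discharge/Sec3TemperedFrobenioidConnectedPartNonVacuity.lean` (the INHABITANT
`Toy.temperedFrobenioidQConnectedPart X` of the tempered-Frobenioid interface over `B^temp(Π^tp_X)⁰` — perfect toy divisor
data `Φ = ℚ_{≥0}`, `B = ℤ ×_{(ℚ_{≥0})^gp} (ℚ_{≥0})^gp` constant along the base — and the §4 setting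
`Toy.biKummerSettingConnectedPart X M NH` built from it by abc-iut-L2-t4's `mkOfConnectedTemperoid`, with the GENUINE Galois
objects and Galois surjections of the temperoid and `A_⊙ := (Π^tp_X/M, 0)`); abc-iut cell, block F, FACT-LIST row F-0729.

For that witness the divisor and rational-function monoids are CONSTANT along the base, so pull-back along every arrow of
`B^temp(Π^tp_X)⁰` is a bijection on `Φ` and on `B` (`Toy.pull_divisorMonoid_connectedPart_bijective`,
`Toy.pull_ratFnFunctor_connectedPart_bijective`); hence the descent inputs (Φ), (B) of
`remark411_mkOfConnectedTemperoid_of_galoisDescent` hold trivially, (Q) is abc-iut-f-108's theorem `galOver_descent`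
([SemiAnbd] Rmk. 3.1.3), and:

* **`Toy.remark411_biKummerSettingConnectedPart`** — `(Toy.biKummerSettingConnectedPart X M NH).Remark411`, for EVERY
  `Π^tp_X ↠ G_K` of the [SemiAnbd] interface, every open normal `M ≤ Π^tp_X` and every `(N,H)`-saturation relation `NH`:
  every morphism of base-Frobenius type is a categorical quotient of its domain by `G · μ_N(A)`.

This is a POSITIVE instance of the named fact over a base category with genuinely NON-invertible arrows (`Π/N → Π/M` for
`N < M`), complementing abc-iut-w5-d063's `Toy.remark411` (one-object base: every base arrow invertible) and
abc-iut-f-108's span-base refutation `not_forall_remark411` — so neither `Remark411` nor `¬ Remark411` is a theorem of the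
§4 interface over connected, totally epimorphic bases with non-trivial arrows: the row is decided by the base category AND
the descent behaviour of the divisor data, exactly the two inputs print takes from [SemiAnbd] §3 / [EtTh] Prop. 3.4.
HONEST LIMITS: the divisor data of the witness are toy (only the base, its Galois objects and the outer Galois surjections
are the genuine ones of `Π^tp_X`); inhabited ≠ faithful; nothing here bears on [IUTchIII] Cor. 3.12.
-/

noncomputable section

namespace Literature.AnabelianGeometry.EtaleTheta

open CategoryTheory Opposite Literature.AlgebraicGeometry.Frobenioids Literature.AnabelianGeometry.SemiGraphs
open scoped NNRat

namespace Toy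

variable {K : Type} [Field K] (X : SemiGraphs.TemperedArithmeticGroup.{0} K)

/-! ### Pull-back along any arrow of `B^temp(Π^tp_X)⁰` is bijective on the (constant) divisor data of the witness -/

/-- The groupification of a bijective homomorphism of commutative monoids is injective (indeed bijective): it has the
groupification of the inverse as a left inverse. [folklore] -/
private theorem monGp_map_injective_of_bijective {M N : Type} [CommMonoid M] [CommMonoid N] (f : M →* N)
    (hf : Function.Bijective f) : Function.Injective (MonGp.map f) := by
  let e : M ≃* N := MulEquiv.ofBijective f hf
  have hcomp : e.symm.toMonoidHom.comp f = MonoidHom.id M := MonoidHom.ext fun x => e.symm_apply_apply x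
  have h : (MonGp.map e.symm.toMonoidHom).comp (MonGp.map f) = MonoidHom.id _ := by
    rw [← MonGp.map_comp, hcomp, MonGp.map_id]
  intro a b hab
  have h' := congrArg (MonGp.map e.symm.toMonoidHom) hab
  rwa [← MonoidHom.comp_apply, ← MonoidHom.comp_apply, h, MonoidHom.id_apply, MonoidHom.id_apply] at h'

/-- `gpMap` (groupification of a homomorphism, `DivisorMonoids.lean`) of the identity is the identity. [folklore] -/
private theorem gpMap_id_apply {M : Type} [CommMonoid M] (ξ : Algebra.GrothendieckGroup M) :
    gpMap (MonoidHom.id M) ξ = ξ := by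
  change MonGp.map (MonoidHom.id M) ξ = ξ
  rw [MonGp.map_id, MonoidHom.id_apply]

/-- **Pull-back on `Φ = ℚ_{≥0}` along ANY arrow of `B^temp(Π^tp_X)⁰` is the identity of `ℚ_{≥0}`, hence bijective** (the
divisor monoid of the witness is constant along the base). [cite: MochizukiEtTh2009, Def 3.6 p.302 (PDF p.76)] -/
theorem pull_divisorMonoid_connectedPart_bijective {A₁ B₁ : ConnectedPart (BTemp X.Pi)} (p : A₁ ⟶ B₁) :
    Function.Bijective (pull (temperedFrobenioidQConnectedPart X).divisorMonoid p) := by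
  constructor
  · intro z z' h
    exact Subtype.ext (congrArg Subtype.val h)
  · intro z
    exact ⟨⟨z.1, trivial⟩, Subtype.ext rfl⟩

/-- Hence pull-back along any arrow is injective on `Φ^gp`. [cite: MochizukiEtTh2009, Def 3.6 p.302 (PDF p.76)] -/
theorem pullGp_divisorMonoid_connectedPart_injective {A₁ B₁ : ConnectedPart (BTemp X.Pi)} (p : A₁ ⟶ B₁) :
    Function.Injective (pullGp (temperedFrobenioidQConnectedPart X).divisorMonoid p) :=
  monGp_map_injective_of_bijective _ (pull_divisorMonoid_connectedPart_bijective X p)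

/-- On the witness, the pull-back `Φ(B₁) → Φ(A₁)` of the subfunctor `Φ` is the identity homomorphism of `ℚ_{≥0}`.
[cite: MochizukiEtTh2009, Def 3.6 p.302 (PDF p.76)] -/
private theorem Φ_pull_eq_id {A₁ B₁ : (ConnectedPart (BTemp X.Pi))ᵒᵖ} (f : A₁ ⟶ B₁) :
    (temperedFrobenioidQConnectedPart X).Φ.pull f = MonoidHom.id _ :=
  MonoidHom.ext fun _ => Subtype.ext rfl

/-- **Pull-back on `B = ℤ ×_{(ℚ_{≥0})^gp} (ℚ_{≥0})^gp` along ANY arrow of `B^temp(Π^tp_X)⁰` is bijective** (the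
rational-function monoid of the witness is constant along the base). [cite: MochizukiEtTh2009, Def 3.6 p.303 (PDF p.77)] -/
theorem pull_ratFnFunctor_connectedPart_bijective {A₁ B₁ : ConnectedPart (BTemp X.Pi)} (p : A₁ ⟶ B₁) :
    Function.Bijective (pull (temperedFrobenioidQConnectedPart X).ratFnFunctor p) := by
  have hgp : ∀ ξ : Algebra.GrothendieckGroup ((temperedFrobenioidQConnectedPart X).Φ.carrier (op B₁)),
      gpMap ((temperedFrobenioidQConnectedPart X).Φ.pull p.op) ξ = ξ := fun ξ => by
    rw [Φ_pull_eq_id X p.op]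
    exact gpMap_id_apply ξ
  constructor
  · intro t t' h
    have h1 : ((temperedFrobenioidQConnectedPart X).ratFnPull p.op t).val =
        ((temperedFrobenioidQConnectedPart X).ratFnPull p.op t').val := congrArg Subtype.val h
    rw [TemperedFrobenioid.coe_ratFnPull, TemperedFrobenioid.coe_ratFnPull, hgp, hgp] at h1
    obtain ⟨hb, hξ⟩ := Prod.mk.inj h1
    exact Subtype.ext (Prod.ext hb hξ)
  · intro t
    refine ⟨⟨(t.1.1, t.1.2), t.2⟩, Subtype.ext (Prod.ext rfl ?_)⟩
    change gpMap ((temperedFrobenioidQConnectedPart X).Φ.pull p.op) t.1.2 = t.1.2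
    exact hgp t.1.2

/-- `Φ = ℚ_{≥0}` of the witness is objectwise divisorial (`ℚ`-monoprime ⇒ divisorial; binder `hΦd`).
[cite: MochizukiEtTh2009, Def 3.6 p.303 (PDF p.77)] -/
theorem divisorMonoid_connectedPart_isDivisorial :
    Objectwise (fun M _ => IsDivisorial M) (temperedFrobenioidQConnectedPart X).divisorMonoid :=
  fun _ => (isMonoprime_of_eq_top_nnrat (S := (⊤ : Submonoid (Multiplicative ℚ≥0))) rfl).isDivisorial

/-! ### Remark 4.1.1 at the witness -/

/-- **[EtTh] Remark 4.1.1 HOLDS at the §4 setting over the GENUINE base `B^temp(Π^tp_X)⁰` with toy divisor data —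
UNCONDITIONALLY**: for every `Π^tp_X ↠ G_K`, every open normal `M ≤ Π^tp_X` (`A_⊙ := (Π^tp_X/M, 0)`) and every
saturation relation `NH`, every morphism `α : A → B` of base-Frobenius type of `Toy.biKummerSettingConnectedPart X M NH` is a
categorical quotient of `A` by `G · μ_N(A)` (among all objects, in particular the Frobenius-trivial ones).  Inputs: (Q) =
abc-iut-f-108's `galOver_descent` ([SemiAnbd] Rmk. 3.1.3); (Φ), (B) = bijectivity of pull-back on the constant data; `Φ`
divisorial = `ℚ_{≥0}` monoprime. [cite: MochizukiEtTh2009, Rmk 4.1.1 p.88] -/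
theorem remark411_biKummerSettingConnectedPart (M : OpenNormalSubgroup X.Pi)
    (NH : Subgroup (Field.absoluteGaloisGroup K) → (temperedFrobenioidQConnectedPart X).category → ℕ+ → Prop) :
    (biKummerSettingConnectedPart X M NH).Remark411 :=
  BiKummerSetting.remark411_mkOfConnectedTemperoid_of_galoisDescent X (temperedFrobenioidQConnectedPart X)
    (temperedFrobenioidQConnectedPart_monoidType X) (temperedFrobenioidQConnectedPart_isPerfect X) NH
    ((temperedFrobenioidQConnectedPart X).connQuotZeroObj M)
    (TemperedFrobenioid.isFrobeniusTrivial_connQuotZeroObj _ M)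
    (TemperedFrobenioid.isGaloisObj_connQuotZeroObj_base _ M) (divisorMonoid_connectedPart_isDivisorial X)
    (fun _ _ p _ => ⟨fun z _ => (pull_divisorMonoid_connectedPart_bijective X p).2 z,
      pullGp_divisorMonoid_connectedPart_injective X p⟩)
    (fun _ _ p _ => ⟨fun t _ => (pull_ratFnFunctor_connectedPart_bijective X p).2 t,
      (pull_ratFnFunctor_connectedPart_bijective X p).1⟩)

/-- **The named fact `Remark411` is SATISFIABLE over a connected, totally epimorphic base with NON-invertible arrows**
(contrast `not_forall_remark411`, span base): the §4 setting over `B^temp(Π^tp_X)⁰` with `A_⊙ := (Π^tp_X/Π^tp_X, 0)`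
satisfies it. [cite: MochizukiEtTh2009, Rmk 4.1.1 p.88] -/
theorem exists_biKummerSetting_connectedPart_remark411 :
    ∃ S : BiKummerSetting X realifiedQ (ConnectedPart (BTemp X.Pi)) (catVocabConnectedPart X), S.Remark411 :=
  ⟨biKummerSettingConnectedPart X { (⊤ : OpenSubgroup X.Pi) with isNormal' := ⟨fun _ _ _ => OpenSubgroup.mem_top _⟩ }
      fun _ _ _ => True,
    remark411_biKummerSettingConnectedPart X _ _⟩

end Toy

end Literature.AnabelianGeometry.EtaleTheta

end
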